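import Summits.BirchSwinnertonDyer.BirchSwinnertonDyer.Theorems.PrintCFramBottomClassIndexLawFiveLeBernoulliUnitsOfKrizLi
import Summits.BirchSwinnertonDyer.BirchSwinnertonDyer.Theorems.PrintCFramBottomClassIndexLawFiveLeBernoulliUnitsMazurWilesCurrency
import Summits.BirchSwinnertonDyer.BirchSwinnertonDyer.Theorems.PrintCFramBottomClassIndexLawFiveLeBernoulliUnitsKroneckerOdd
import Literature.NumberTheory.EllipticCurves.HeegnerHypothesisKroneckerProofs
import Summits.BirchSwinnertonDyer.BirchSwinnertonDyer.Theorems.PrintCFramBottomClassIndexLawFiveLeBorelNoPTorsionInputs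
import HarnessLib

/-!
# Crux `PrintCFram.BottomClassIndexLawFiveLe` (stmt-BirchSwinnertonDyer-20372), line `eisenstein-resource-bdp-line` (registry v10):
# THE BERNOULLI UNITS OF THE KRIZ–LI DATUM, part II — END STATES ON THE CLASS: Kriz–Li's hypothesis (4) SPLITS into
# `‖B_{1,ψ₀⁻¹ε_K}‖_p = 1 ∧ ‖B_{1,ψ₀ω⁻¹}‖_p = 1` for EVERY character datum of a CM-ramified class member, and the TWO
# MAZUR–WILES INPUTS `X₁ = ψ₀ε_K`, `X₂ = ψ₀⁻¹ω` of the six-term table come with all of Mazur–Wiles' Dirichlet-side hypotheses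
# (cell `bsd-print-cfram`, width seat `bsd-line-cfram-p1-w3` g4; THEOREMS ONLY, `--supports` 20372; BSD is not proved by any of this)

HONEST FRAMING. Nothing here is a statement about BSD; no stub of the skeleton is closed. Part I (`…BernoulliUnitsOfKrizLi`) proved
integrality of Kriz–Li's pair for the explicit class character and its transfer along `ψ'↑ = ψ↑ ∨ ψ'↑ = ψ⁻¹↑·ω↑`; part M
(`…BernoulliUnitsMazurWilesCurrency`) the dictionary to Mazur–Wiles' currency; part K (`…BernoulliUnitsKroneckerOdd`) that `ε_K` is
odd. Here, on the CM-ramified class (`p ≥ 5`):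

* §5 `norm_bernoulliPair_le_one_of_hss` (every datum `(f, ψ)` with `hss` has a `p`-integral pair, `p ∤ d`),
  **`norm_bernoulliPair_eq_one_of_hss`** ((4) ⟺ both units), `…_of_hss_of_eq_or_eq` (the same for every `ψ₁` with LEAD g8's
  disjunction — the Teichmüller lift of the character of ANY stable line), **`norm_bernoulliPair_eq_one_of_heegner`** (Stub H's
  binders verbatim: `p ∤ d_K` because `p ∣ N_W` — w2's `BorelTorsion.dvd_conductorNorm_of_cmRamified` — splits in the Heegner field);
* §7 **`mazurWilesInputs_of_heegner`**: for `X₁ = ψ₁,₀·ε_K` (odd lift of `θ_S` = reflection partner of the even lift of `θ_Q`) and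
  `X₂ = ψ₁,₀⁻¹·ω` (odd lift of `θ_Q` = reflection partner of the even lift of `θ_S`): `X̃ᵢ` primitive, odd, `≠ ω`, `‖B_{1,X̃ᵢ⁻¹}‖_p = 1`
  — every hypothesis of `MazurWiles1984.thm2_…` on the Dirichlet character except the avatar relation (Galois side: LEAD g8 / w6);
  `mazurWilesInputs'_of_heegner` is the same in the `bernoulliOnePrim` / level-uniform «`≠ ω`» currency of w6's
  `HerbrandOddClassGroup*` consumer forms (via `level_eq_prime_of_forall_norm_sub_lt_one`: a primitive character congruent to
  the identity has level `p`).
  No input beyond Stub H's binders (`ε_K` odd is part K's `odd_of_isKroneckerCharacterOf`; `ψ.IsPrimitive` is not used).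

So the six terms of (M1) need from the Bernoulli side NOTHING beyond these two unit statements (rows «odd class group», «even
class group» via reflection, «unit index» via `L_p(χ_e,1) ≡ −B_{1,χ_eω⁻¹}`, `χ_eω⁻¹ ∈ {X₂⁻¹, X₁⁻¹}`). beyond-print theorem: NO.
References: [KrizLi2019] Thm. 1.20, §7.1; [MazurWiles1984] Thm. 2; [GrossLMS1991] §1 (Heegner hypothesis); the herbrand M1 memo §§5–8.
-/

set_option autoImplicit false
set_option linter.dupNamespace false

noncomputable section

open scoped Classical
open DirichletCharacter Literature.NumberTheory.LFunctions Literature.NumberTheory.EllipticCurves.KrizLi2019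
  Literature.NumberTheory.EllipticCurves Literature.NumberTheory.EllipticCurves.Rank1Residual

namespace Summit.BirchSwinnertonDyer.BirchSwinnertonDyer.Theorems.PrintCFram.BernoulliUnits

open Summit.BirchSwinnertonDyer.BirchSwinnertonDyer.Theorems.PrintCFram

variable {p : ℕ} [hp : Fact p.Prime]

/-! ## §5 END STATES on the CM-ramified class -/

section EndStates

variable (W : WeierstrassCurve ℚ) [W.IsElliptic]

/-- **Every Kriz–Li datum of the class has `p`-integral Bernoulli numbers.** For `W/ℚ` elliptic with CM, `p ≥ 5` CM-ramified,
`ω` Teichmüller, ANY character datum `(f, ψ)` with the trace form `hss` for `W` (odd or even `ψ`), and ANY `ε_K` mod `d` with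
`p ∤ d`: `‖B_{1,ψ₀⁻¹ε_K}‖_p ≤ 1` and `‖B_{1,ψ₀ω⁻¹}‖_p ≤ 1`. (By uniqueness of the Eisenstein pair `ψ↑ ∈ {ψ_c↑, ψ_c⁻¹↑ω↑}` for the
explicit class character `ψ_c`, whose pair is integral, §3.) [cite: KrizLi2019, Thm. 1.20 (p. 8), §7.1 (p. 43), Cor. 8.4]
[cite: Mazur1978, Prop. 6.3 (1) (p. 153)] -/
theorem norm_bernoulliPair_le_one_of_hss (hCM : W.HasCM) (hram : CMRamified W p) (h5 : 5 ≤ p)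
    {ω : DirichletCharacter ℚ_[p] p} (hω : IsTeichmullerCharacter ω)
    {f : ℕ} [NeZero f] (ψ : DirichletCharacter ℚ_[p] f)
    (hss : ∀ ℓ : ℕ, ℓ.Prime → ¬ (ℓ ∣ p * W.conductorNorm ℤ) →
      ‖((W.LFunction ℓ : ℤ) : ℚ_[p]) - (ψ (ℓ : ZMod f) + ψ⁻¹ (ℓ : ZMod f) * ω (ℓ : ZMod p))‖ < 1)
    {d : ℕ} [NeZero d] (εK : DirichletCharacter ℚ_[p] d) (hpd : ¬ p ∣ d) :
    ‖bernoulliOnePrim (bernoulliCharOne ψ εK)‖ ≤ 1 ∧ ‖bernoulliOnePrim (bernoulliCharTwo ψ εK ω)‖ ≤ 1 := by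
  have hpp := hp.out
  have hp2 : p ≠ 2 := by omega
  have hωodd : ω.Odd := KrizLiBinders.teichmuller_apply_neg_one hp2 hω
  obtain ⟨m, hm, χ, ε, k, hmp, hχ, hχq, hε, -, hk2, hkp, hpar, htr, hgoodW⟩ :=
    KrizLiBinders.exists_krizLiData_of_cmRamified W hCM hram h5
  haveI := hm
  haveI : NeZero (p * m) := ⟨Nat.mul_ne_zero hpp.ne_zero hm.out⟩
  obtain ⟨-, hssc, -, -⟩ :=
    KrizLiBinders.krizLiBinders_of_data hp2 W χ hχ hχq hmp ε (fun ℓ _ _ => hε ℓ) hk2 hkp htr hgoodW ω hω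
  set ψc : DirichletCharacter ℚ_[p] (p * m) :=
    changeLevel (dvd_mul_left m p) χ * changeLevel (dvd_mul_right p m) (ω ^ k) with hψc
  have hodd : ¬ ψc.Even :=
    EisensteinPair.not_even_of_odd' ψc (KrizLiBinders.psi_odd_of ω χ k hp2 hω (by omega) hpar)
  have hdp : d.Coprime p := (Nat.Prime.coprime_iff_not_dvd hpp).mpr hpd |>.symm
  have hint : ‖bernoulliOnePrim (bernoulliCharOne ψc εK)‖ ≤ 1 ∧ ‖bernoulliOnePrim (bernoulliCharTwo ψc εK ω)‖ ≤ 1 :=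
    ⟨norm_bernoulliCharOne_classCharacter_le_one hp2 χ hmp hk2 hkp hω hodd εK,
      norm_bernoulliCharTwo_classCharacter_le_one hp2 χ hmp hk2 hkp hω hodd εK hdp⟩
  -- the disjunction `ψ↑ = ψc↑ ∨ ψ↑ = ψc⁻¹↑ ω↑` at level `(p m) f p`
  haveI : NeZero (p * m * f * p) := ⟨Nat.mul_ne_zero (Nat.mul_ne_zero (NeZero.ne (p * m)) (NeZero.ne f)) hpp.ne_zero⟩
  have h₁ : p * m ∣ p * m * f * p := dvd_mul_of_dvd_left (dvd_mul_right (p * m) f) p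
  have h₂ : f ∣ p * m * f * p := dvd_mul_of_dvd_left (dvd_mul_left f (p * m)) p
  have hpM : p ∣ p * m * f * p := dvd_mul_left p (p * m * f)
  have hN : p * W.conductorNorm ℤ ≠ 0 := Nat.mul_ne_zero hpp.ne_zero W.conductorNorm_pos_holds.ne'
  have e := EisensteinPair.eq_or_eq_of_traceForm_congr hp2 h₁ h₂ hpM ψc ψ ω hN
    (EisensteinPair.traceForm_congr_of_hss W ψc ψ ω hssc hss)
  exact (norm_pair_le_one_iff_of_eq_or_eq h₁ h₂ hpM ψc ψ εK ω hωodd e).mpr hint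

/-- **KRIZ–LI'S (4) SPLITS INTO TWO UNITS.** For `W/ℚ` elliptic with CM, `p ≥ 5` CM-ramified, `ω` Teichmüller, ANY character datum
`(f, ψ)` with `hss` for `W`, ANY `ε_K` mod `d` with `p ∤ d`, hypothesis (4) `¬ ‖B_{1,ψ₀⁻¹ε_K}·B_{1,ψ₀ω⁻¹}‖ ≤ p⁻¹` is equivalent to
**`‖B_{1,ψ₀⁻¹ε_K}‖_p = 1 ∧ ‖B_{1,ψ₀ω⁻¹}‖_p = 1`** — the two numbers that serve all six terms of the M1 table (odd class groups of
`ψ₀ε_K` and `ψ₀⁻¹ω`; even class groups and unit indices of `ψ₀` and `ψ₀⁻¹ωε_K`). [cite: KrizLi2019, Thm. 1.20 (p. 8), §7.1 (p. 43)]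
[cite: MazurWiles1984, Thm. 2 (p. 216)] -/
theorem norm_bernoulliPair_eq_one_of_hss (hCM : W.HasCM) (hram : CMRamified W p) (h5 : 5 ≤ p)
    {ω : DirichletCharacter ℚ_[p] p} (hω : IsTeichmullerCharacter ω)
    {f : ℕ} [NeZero f] (ψ : DirichletCharacter ℚ_[p] f)
    (hss : ∀ ℓ : ℕ, ℓ.Prime → ¬ (ℓ ∣ p * W.conductorNorm ℤ) →
      ‖((W.LFunction ℓ : ℤ) : ℚ_[p]) - (ψ (ℓ : ZMod f) + ψ⁻¹ (ℓ : ZMod f) * ω (ℓ : ZMod p))‖ < 1)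
    {d : ℕ} [NeZero d] (εK : DirichletCharacter ℚ_[p] d) (hpd : ¬ p ∣ d)
    (h4 : ¬ ‖bernoulliOnePrim (bernoulliCharOne ψ εK) * bernoulliOnePrim (bernoulliCharTwo ψ εK ω)‖ ≤ (p : ℝ)⁻¹) :
    ‖bernoulliOnePrim (bernoulliCharOne ψ εK)‖ = 1 ∧ ‖bernoulliOnePrim (bernoulliCharTwo ψ εK ω)‖ = 1 := by
  have hb := norm_bernoulliPair_le_one_of_hss W hCM hram h5 hω ψ hss εK hpd
  exact norm_eq_one_and_of_not_norm_mul_le hb.1 hb.2 h4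

/-- **… and for EVERY character related to `ψ` by `ψ↑ = ψ₁↑ ∨ ψ↑ = ψ₁⁻¹↑·ω↑`** — the exact output of LEAD g8's
`HerbrandLineCharacters.exists_dirichletCharacter_charSub_eq_or_eq_of_hss` for the Teichmüller lift `ψ₁` of the line character `b`
(at level `f·m·p`; any common level and any divisibility proofs are accepted): **`‖B_{1,ψ₁,₀⁻¹ε_K}‖_p = 1 ∧ ‖B_{1,ψ₁,₀ ω⁻¹}‖_p = 1`**,
where `ψ₁,₀ = evenTwist ψ₁ ε_K`. So the Bernoulli inputs of rows «odd class group», «even class group (reflection partner)» and «unit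
index» of the M1 table, for BOTH line characters `θ_S`, `θ_Q`, are units. [cite: KrizLi2019, Thm. 1.20 (p. 8), §7.1 (p. 43)]
[cite: MazurWiles1984, Thm. 2 (p. 216)] -/
theorem norm_bernoulliPair_eq_one_of_hss_of_eq_or_eq (hCM : W.HasCM) (hram : CMRamified W p) (h5 : 5 ≤ p)
    {ω : DirichletCharacter ℚ_[p] p} (hω : IsTeichmullerCharacter ω)
    {f : ℕ} [NeZero f] (ψ : DirichletCharacter ℚ_[p] f)
    (hss : ∀ ℓ : ℕ, ℓ.Prime → ¬ (ℓ ∣ p * W.conductorNorm ℤ) →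
      ‖((W.LFunction ℓ : ℤ) : ℚ_[p]) - (ψ (ℓ : ZMod f) + ψ⁻¹ (ℓ : ZMod f) * ω (ℓ : ZMod p))‖ < 1)
    {d : ℕ} [NeZero d] (εK : DirichletCharacter ℚ_[p] d) (hpd : ¬ p ∣ d)
    (h4 : ¬ ‖bernoulliOnePrim (bernoulliCharOne ψ εK) * bernoulliOnePrim (bernoulliCharTwo ψ εK ω)‖ ≤ (p : ℝ)⁻¹)
    {m : ℕ} [NeZero m] (ψ₁ : DirichletCharacter ℚ_[p] m) {M : ℕ} [NeZero M] (hf : f ∣ M) (hm : m ∣ M) (hpM : p ∣ M)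
    (e : changeLevel hf ψ = changeLevel hm ψ₁ ∨ changeLevel hf ψ = changeLevel hm ψ₁⁻¹ * changeLevel hpM ω) :
    ‖bernoulliOnePrim (bernoulliCharOne ψ₁ εK)‖ = 1 ∧ ‖bernoulliOnePrim (bernoulliCharTwo ψ₁ εK ω)‖ = 1 := by
  have hp2 : p ≠ 2 := by have := hp.out.two_le; omega
  have hωodd : ω.Odd := KrizLiBinders.teichmuller_apply_neg_one hp2 hω
  exact (norm_pair_eq_one_iff_of_eq_or_eq hm hf hpM ψ₁ ψ εK ω hωodd e).mp
    (norm_bernoulliPair_eq_one_of_hss W hCM hram h5 hω ψ hss εK hpd h4)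

variable [W.IsGloballyMinimal]

/-- **END STATE WITH STUB H'S BINDERS VERBATIM.** For `W/ℚ` globally minimal with CM, `p ≥ 5` CM-ramified, `N = N_W`, `K` imaginary
quadratic with the Heegner hypothesis for `N` (so `p ∤ d_K`: `p ∣ N_W` splits), Kriz–Li's `(f, ψ, ω, ε_K)` with `hss` and hypothesis
(4): **`‖B_{1,ψ₀⁻¹ε_K}‖_p = 1 ∧ ‖B_{1,ψ₀ω⁻¹}‖_p = 1`**, and the same for every `ψ₁` with `ψ↑ = ψ₁↑ ∨ ψ↑ = ψ₁⁻¹↑·ω↑` (the Teichmüller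
lift of the character of ANY stable line `Φ`, LEAD g8 T1). Neither `ψ.IsPrimitive` nor `IsKroneckerCharacterOf K εK` is used.
[cite: KrizLi2019, Thm. 1.20 (pp. 7–8), §7.1 (p. 43)] [cite: GrossLMS1991, §1 (p. 235)] [cite: MazurWiles1984, Thm. 2 (p. 216)] -/
theorem norm_bernoulliPair_eq_one_of_heegner (hCM : W.HasCM) (hram : CMRamified W p) (h5 : 5 ≤ p)
    (N : ℕ) (K : Type) [Field K] [NumberField K]
    {f : ℕ} [NeZero f] (ψ : DirichletCharacter ℚ_[p] f) (ω : DirichletCharacter ℚ_[p] p)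
    (εK : DirichletCharacter ℚ_[p] (NumberField.discr K).natAbs)
    (hN : W.conductorNorm ℤ = N) (hK : IsImaginaryQuadratic K) (hH : SatisfiesHeegnerHypothesis N K)
    (hω : IsTeichmullerCharacter ω)
    (hss : ∀ ℓ : ℕ, ℓ.Prime → ¬ (ℓ ∣ p * W.conductorNorm ℤ) →
      ‖((W.LFunction ℓ : ℤ) : ℚ_[p]) - (ψ (ℓ : ZMod f) + ψ⁻¹ (ℓ : ZMod f) * ω (ℓ : ZMod p))‖ < 1)
    (h4 : ¬ ‖bernoulliOnePrim (bernoulliCharOne ψ εK) * bernoulliOnePrim (bernoulliCharTwo ψ εK ω)‖ ≤ (p : ℝ)⁻¹) :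
    (‖bernoulliOnePrim (bernoulliCharOne ψ εK)‖ = 1 ∧ ‖bernoulliOnePrim (bernoulliCharTwo ψ εK ω)‖ = 1) ∧
      ∀ {m : ℕ} [NeZero m] (ψ₁ : DirichletCharacter ℚ_[p] m) {M : ℕ} [NeZero M] (hf : f ∣ M) (hm : m ∣ M) (hpM : p ∣ M),
        (changeLevel hf ψ = changeLevel hm ψ₁ ∨ changeLevel hf ψ = changeLevel hm ψ₁⁻¹ * changeLevel hpM ω) →
        ‖bernoulliOnePrim (bernoulliCharOne ψ₁ εK)‖ = 1 ∧ ‖bernoulliOnePrim (bernoulliCharTwo ψ₁ εK ω)‖ = 1 := by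
  have hpd : ¬ p ∣ (NumberField.discr K).natAbs := by
    rw [← Int.natCast_dvd]
    exact Literature.SatisfiesHeegnerHypothesis.not_dvd_discr hK.1 hH hp.out (hN ▸ BorelTorsion.dvd_conductorNorm_of_cmRamified W p hCM hram)
  exact ⟨norm_bernoulliPair_eq_one_of_hss W hCM hram h5 hω ψ hss εK hpd h4,
    fun ψ₁ _ _ hf hm hpM e => norm_bernoulliPair_eq_one_of_hss_of_eq_or_eq W hCM hram h5 hω ψ hss εK hpd h4 ψ₁ hf hm hpM e⟩

end EndStates

/-! ## §7 THE TWO MAZUR–WILES INPUTS of the six-term table: `X₁ = ψ₀ε_K`, `X₂ = ψ₀⁻¹ω` -/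

section MazurWilesInputs

variable {m d : ℕ} [NeZero m] [NeZero d]

omit [NeZero m] [NeZero d] in
/-- `X₁⁻¹ = ψ₀⁻¹ε_K`: the inverse of the odd lift `X₁ = ψ₀·ε_K↑` (level `m·d`) is Kriz–Li's first Bernoulli character, for `ε_K`
quadratic. [cite: KrizLi2019, Thm. 1.20 (p. 8)] -/
theorem evenTwist_mul_inv_eq_bernoulliCharOne (ψ₁ : DirichletCharacter ℚ_[p] m) {εK : DirichletCharacter ℚ_[p] d}
    (hεq : εK⁻¹ = εK) :
    (evenTwist ψ₁ εK * changeLevel (dvd_mul_left d m) εK)⁻¹ = bernoulliCharOne ψ₁ εK := by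
  unfold bernoulliCharOne
  rw [mul_inv, ← map_inv, hεq]

omit [NeZero m] [NeZero d] in
/-- `X₂⁻¹ = ψ₀ω⁻¹`: the inverse of the odd lift `X₂ = ψ₀⁻¹↑·ω↑` (level `m·d·p`) is Kriz–Li's second Bernoulli character.
[cite: KrizLi2019, Thm. 1.20 (p. 8)] -/
theorem evenTwist_inv_mul_inv_eq_bernoulliCharTwo (ψ₁ : DirichletCharacter ℚ_[p] m) (εK : DirichletCharacter ℚ_[p] d)
    (ω : DirichletCharacter ℚ_[p] p) :
    (changeLevel (dvd_mul_right (m * d) p) (evenTwist ψ₁ εK)⁻¹ * changeLevel (dvd_mul_left p (m * d)) ω)⁻¹ =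
      bernoulliCharTwo ψ₁ εK ω := by
  unfold bernoulliCharTwo
  rw [mul_inv, ← map_inv, ← map_inv, inv_inv]

/-- `X₁ = ψ₀·ε_K↑` is ODD (`ψ₀` even, `ε_K` odd). [cite: KrizLi2019, §1.5 (p. 7)] -/
theorem evenTwist_mul_odd (ψ₁ : DirichletCharacter ℚ_[p] m) {εK : DirichletCharacter ℚ_[p] d} (hε : εK.Odd) :
    (evenTwist ψ₁ εK * changeLevel (dvd_mul_left d m) εK).Odd := by
  have h0 : evenTwist ψ₁ εK (-1) = 1 := evenTwist_even ψ₁ hε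
  unfold DirichletCharacter.Odd
  rw [MulChar.mul_apply, h0, EisensteinPair.changeLevel_apply_neg_one, hε, one_mul]

/-- `X₂ = ψ₀⁻¹↑·ω↑` is ODD (`ψ₀` even, `ω` odd). [cite: KrizLi2019, §1.5 (p. 7)] -/
theorem evenTwist_inv_mul_odd (ψ₁ : DirichletCharacter ℚ_[p] m) {εK : DirichletCharacter ℚ_[p] d} (hε : εK.Odd)
    {ω : DirichletCharacter ℚ_[p] p} (hω : ω.Odd) :
    (changeLevel (dvd_mul_right (m * d) p) (evenTwist ψ₁ εK)⁻¹ * changeLevel (dvd_mul_left p (m * d)) ω).Odd := by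
  have h0 : evenTwist ψ₁ εK (-1) = 1 := evenTwist_even ψ₁ hε
  unfold DirichletCharacter.Odd
  rw [MulChar.mul_apply, EisensteinPair.changeLevel_apply_neg_one, MulChar.inv_apply_eq_inv', h0,
    EisensteinPair.changeLevel_apply_neg_one, hω, inv_one, one_mul]

/-- **MAZUR–WILES' FOUR DIRICHLET-SIDE HYPOTHESES for an odd character `X`, from parity and ONE unit statement.** If `X` (any
level `n`) is odd and `‖bernoulliOnePrim X⁻¹‖_p = 1`, then its primitive character `X̃` (level `𝔣(X)`) is primitive, odd, satisfies
Mazur–Wiles' «`≠ ω`» clause, and `‖B_{1,X̃⁻¹}‖_p = 1` — everything `MazurWiles1984.thm2_oddChiPart_classGroup_card_eq_pow_val_bernoulli`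
asks of the Dirichlet character except the avatar relation. [cite: MazurWiles1984, Thm. 2 (p. 216)] -/
theorem mazurWiles_dirichletHypotheses_of_odd_of_norm_eq_one (hp2 : p ≠ 2) {n : ℕ} [NeZero n]
    (X : DirichletCharacter ℚ_[p] n) (hodd : X.Odd) (hB : ‖bernoulliOnePrim X⁻¹‖ = 1) :
    X.primitiveCharacter.IsPrimitive ∧ X.primitiveCharacter.Odd ∧
      ¬ (X.conductor = p ∧ ∀ a : ℤ, ¬ ((p : ℤ) ∣ a) →
          ‖X.primitiveCharacter (a : ZMod X.conductor) - (a : ℚ_[p])‖ < 1) ∧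
      ‖@generalizedBernoulli ℚ_[p] _ _ X.conductor ⟨X.conductor_ne_zero⟩ 1 X.primitiveCharacter⁻¹‖ = 1 := by
  haveI : NeZero X.conductor := ⟨X.conductor_ne_zero⟩
  have hB' : ‖@generalizedBernoulli ℚ_[p] _ _ X.conductor ⟨X.conductor_ne_zero⟩ 1 X.primitiveCharacter⁻¹‖ = 1 := by
    rw [generalizedBernoulli_primitiveCharacter_inv]; exact hB
  exact ⟨primitiveCharacter_isPrimitive X, (primitiveCharacter_odd_iff X).mpr hodd,
    not_isTeichmuller_of_norm_generalizedBernoulli_inv_le_one hp2 X.primitiveCharacter hB'.le, hB'⟩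

/-- **A primitive character congruent to the identity is of level `p`.** If `χ` is PRIMITIVE of level `f` and `χ(a) ≡ a (mod p)`
for every integer `a` prime to `p`, then `f = p`: a prime `ℓ ≠ p` dividing `f` would give `χ(ℓ) = 0 ≢ ℓ`; so `f` is a power of
`p`, at most `p¹` by tameness (`BernoulliIntegral.not_sq_dvd_conductor`), and not `p⁰` (`χ = 1`, `a = 2`). This converts the
level-uniform spelling «`¬ ∀ a ⊥ p, ‖χ a − a‖ < 1`» of «`χ ≠ ω`» (w6's `HerbrandOddClassGroup*` consumer forms) into Mazur–Wiles'
«`¬ (f = p ∧ …)`». [cite: Washington1997, §5.1 and Cor. 5.15] -/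
theorem level_eq_prime_of_forall_norm_sub_lt_one (hp2 : p ≠ 2) {f : ℕ} [NeZero f] (χ : DirichletCharacter ℚ_[p] f)
    (hχ : χ.IsPrimitive) (h : ∀ a : ℤ, ¬ ((p : ℤ) ∣ a) → ‖χ (a : ZMod f) - (a : ℚ_[p])‖ < 1) : f = p := by
  have hpp := hp.out
  -- every prime factor of `f` is `p`
  have hfac : ∀ {ℓ : ℕ}, ℓ.Prime → ℓ ∣ f → ℓ = p := by
    intro ℓ hℓ hℓf
    by_contra hne
    have hpl : ¬ ((p : ℤ) ∣ (ℓ : ℤ)) := by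
      intro hd
      have : p ∣ ℓ := by exact_mod_cast hd
      exact hne ((Nat.prime_dvd_prime_iff_eq hpp hℓ).mp this).symm
    have hval : χ ((ℓ : ℤ) : ZMod f) = 0 := by
      rw [Int.cast_natCast]
      refine MulChar.map_nonunit _ ?_
      rw [ZMod.isUnit_iff_coprime]
      exact fun hc => hℓ.one_lt.ne' (Nat.Coprime.eq_one_of_dvd hc hℓf)
    have hlt := h ℓ hpl
    rw [hval, zero_sub, norm_neg, Int.cast_natCast] at hlt
    have h1 : ‖(ℓ : ℚ_[p])‖ = 1 := by
      rw [Padic.norm_natCast_eq_one_iff]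
      exact (Nat.coprime_primes hpp hℓ).mpr (Ne.symm hne)
    linarith
  have hfpow : f = p ^ f.primeFactorsList.length := Nat.eq_prime_pow_of_unique_prime_dvd (NeZero.ne f) hfac
  -- `p² ∤ f` (tameness) and `f ≠ 1`
  have hsq : ¬ p ^ 2 ∣ f := by
    have := BernoulliIntegral.not_sq_dvd_conductor hp2 χ
    rwa [(isPrimitive_def χ).mp hχ] at this
  have hf1 : f ≠ 1 := by
    intro hf
    subst hf
    have h2 : ¬ ((p : ℤ) ∣ 2) := by
      intro hd
      have : p ∣ 2 := by exact_mod_cast hd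
      exact hp2 ((Nat.prime_dvd_prime_iff_eq hpp Nat.prime_two).mp this)
    have hlt := h 2 h2
    rw [χ.level_one, MulChar.one_apply (isUnit_of_subsingleton _)] at hlt
    have e : (1 : ℚ_[p]) - ((2 : ℤ) : ℚ_[p]) = -1 := by norm_num
    rw [e, norm_neg, norm_one] at hlt
    exact lt_irrefl _ hlt
  set j := f.primeFactorsList.length with hj
  rcases Nat.lt_or_ge j 2 with hj2 | hj2
  · interval_cases j
    · exfalso; apply hf1; rw [hfpow, pow_zero]
    · rw [hfpow, pow_one]
  · exfalso; apply hsq; rw [hfpow]; exact pow_dvd_pow p hj2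

/-- **Level-uniform `ω`-exclusion from integrality** (the spelling of w6's `HerbrandOddClassGroup*` consumer forms): a PRIMITIVE `χ`
with `‖bernoulliOnePrim χ⁻¹‖_p ≤ 1` is NOT congruent to the identity on the integers prime to `p`.
[cite: MazurWiles1984, Thm. 2 (p. 216)] [cite: Washington1997, §5.1, Cor. 5.15] -/
theorem not_forall_norm_sub_lt_one_of_norm_bernoulliOnePrim_inv_le_one (hp2 : p ≠ 2) {f : ℕ} [NeZero f]
    (χ : DirichletCharacter ℚ_[p] f) (hχ : χ.IsPrimitive) (hB : ‖bernoulliOnePrim χ⁻¹‖ ≤ 1) :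
    ¬ ∀ a : ℤ, ¬ ((p : ℤ) ∣ a) → ‖χ (a : ZMod f) - (a : ℚ_[p])‖ < 1 := by
  intro h
  have hf := level_eq_prime_of_forall_norm_sub_lt_one hp2 χ hχ h
  have hprimInv : (χ⁻¹).IsPrimitive := by rw [isPrimitive_def, conductor_inv]; exact hχ
  have hB' : ‖generalizedBernoulli 1 χ⁻¹‖ ≤ 1 := by
    rw [← bernoulliOnePrim_eq_generalizedBernoulli_of_isPrimitive χ⁻¹ hprimInv]; exact hB
  exact not_isTeichmuller_of_norm_generalizedBernoulli_inv_le_one hp2 χ hB' ⟨hf, h⟩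

/-- **Mazur–Wiles' Dirichlet-side hypotheses in the `bernoulliOnePrim` / level-uniform currency** (the exact hypotheses `hprim`,
`hodd`, `hχω`, `hB` of w6's `HerbrandOddClassGroup.classGroup_torsion_eigen_eq_zero_of_absGalois` and relatives), for the primitive
character `X̃` of any ODD `X` with `‖bernoulliOnePrim X⁻¹‖_p = 1`. [cite: MazurWiles1984, Thm. 2 (p. 216)] -/
theorem mazurWiles_dirichletHypotheses'_of_odd_of_norm_eq_one (hp2 : p ≠ 2) {n : ℕ} [NeZero n]
    (X : DirichletCharacter ℚ_[p] n) (hodd : X.Odd) (hB : ‖bernoulliOnePrim X⁻¹‖ = 1) :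
    X.primitiveCharacter.IsPrimitive ∧ X.primitiveCharacter.Odd ∧
      (¬ ∀ a : ℤ, ¬ ((p : ℤ) ∣ a) → ‖X.primitiveCharacter (a : ZMod X.conductor) - (a : ℚ_[p])‖ < 1) ∧
      (haveI : NeZero X.conductor := ⟨X.conductor_ne_zero⟩; ‖bernoulliOnePrim X.primitiveCharacter⁻¹‖ = 1) := by
  haveI : NeZero X.conductor := ⟨X.conductor_ne_zero⟩
  have hprimInv : (X.primitiveCharacter⁻¹).IsPrimitive := by
    rw [isPrimitive_def, conductor_inv]; exact (isPrimitive_def _).mp X.primitiveCharacter_isPrimitive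
  have hB' : ‖bernoulliOnePrim X.primitiveCharacter⁻¹‖ = 1 := by
    rw [bernoulliOnePrim_eq_generalizedBernoulli_of_isPrimitive _ hprimInv, generalizedBernoulli_primitiveCharacter_inv]
    exact hB
  exact ⟨primitiveCharacter_isPrimitive X, (primitiveCharacter_odd_iff X).mpr hodd,
    not_forall_norm_sub_lt_one_of_norm_bernoulliOnePrim_inv_le_one hp2 _ (primitiveCharacter_isPrimitive X) hB'.le, hB'⟩

variable (W : WeierstrassCurve ℚ) [W.IsElliptic] [W.IsGloballyMinimal]

/-- **THE TWO MAZUR–WILES INPUTS OF STUB H (Dirichlet side, END STATE).** Stub H's binders verbatim (`W` globally minimal with CM,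
`p ≥ 5` CM-ramified, Heegner field `K` of `N = N_W`, Kriz–Li's `(f, ψ, ω, ε_K)` with `hss`, `IsKroneckerCharacterOf K ε_K` and (4)),
(the parity `ε_K(−1) = −1` is a THEOREM, part K `odd_of_isKroneckerCharacterOf`), and ANY `ψ₁` with LEAD g8's disjunction `ψ↑ = ψ₁↑ ∨ ψ↑ = ψ₁⁻¹↑·ω↑` (the Teichmüller lift of the character of a stable line):
for BOTH odd characters of the six-term table,
`X₁ = ψ₁,₀·ε_K` (odd lift of `θ_S`; reflection partner of the even lift of `θ_Q`) and
`X₂ = ψ₁,₀⁻¹·ω` (odd lift of `θ_Q`; reflection partner of the even lift of `θ_S`), `ψ₁,₀ = evenTwist ψ₁ ε_K`,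
the primitive character `X̃ᵢ` is PRIMITIVE, ODD, `≠ ω` in Mazur–Wiles' spelling, and **`‖B_{1,X̃ᵢ⁻¹}‖_p = 1`** — i.e. all hypotheses
of `MazurWiles1984.thm2_oddChiPart_classGroup_card_eq_pow_val_bernoulli` on the Dirichlet character, so that its conclusion reads
`#e_θ(ℤ_p ⊗ Cl) = p⁰ = 1` for every Galois `θ` with avatar `X̃ᵢ`. [cite: MazurWiles1984, Thm. 2 (p. 216)]
[cite: KrizLi2019, Thm. 1.20 (pp. 7–8), §7.1 (p. 43)] [cite: Washington1997, Thm. 10.9 (reflection) and §6.3] -/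
theorem mazurWilesInputs_of_heegner (hCM : W.HasCM) (hram : CMRamified W p) (h5 : 5 ≤ p)
    (N : ℕ) (K : Type) [Field K] [NumberField K]
    {f : ℕ} [NeZero f] (ψ : DirichletCharacter ℚ_[p] f) (ω : DirichletCharacter ℚ_[p] p)
    (εK : DirichletCharacter ℚ_[p] (NumberField.discr K).natAbs)
    (hN : W.conductorNorm ℤ = N) (hK : IsImaginaryQuadratic K) (hH : SatisfiesHeegnerHypothesis N K)
    (hω : IsTeichmullerCharacter ω)
    (hss : ∀ ℓ : ℕ, ℓ.Prime → ¬ (ℓ ∣ p * W.conductorNorm ℤ) →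
      ‖((W.LFunction ℓ : ℤ) : ℚ_[p]) - (ψ (ℓ : ZMod f) + ψ⁻¹ (ℓ : ZMod f) * ω (ℓ : ZMod p))‖ < 1)
    (hεK : IsKroneckerCharacterOf K εK)
    (h4 : ¬ ‖bernoulliOnePrim (bernoulliCharOne ψ εK) * bernoulliOnePrim (bernoulliCharTwo ψ εK ω)‖ ≤ (p : ℝ)⁻¹)
    {m : ℕ} [NeZero m] (ψ₁ : DirichletCharacter ℚ_[p] m) {M : ℕ} [NeZero M] (hf : f ∣ M) (hm : m ∣ M) (hpM : p ∣ M)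
    (e : changeLevel hf ψ = changeLevel hm ψ₁ ∨ changeLevel hf ψ = changeLevel hm ψ₁⁻¹ * changeLevel hpM ω) :
    (haveI : NeZero (NumberField.discr K).natAbs := ⟨Int.natAbs_ne_zero.mpr (NumberField.discr_ne_zero K)⟩
    let X₁ : DirichletCharacter ℚ_[p] (m * (NumberField.discr K).natAbs) :=
      evenTwist ψ₁ εK * changeLevel (dvd_mul_left (NumberField.discr K).natAbs m) εK
    let X₂ : DirichletCharacter ℚ_[p] (m * (NumberField.discr K).natAbs * p) :=
      changeLevel (dvd_mul_right (m * (NumberField.discr K).natAbs) p) (evenTwist ψ₁ εK)⁻¹ *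
        changeLevel (dvd_mul_left p (m * (NumberField.discr K).natAbs)) ω
    (X₁.primitiveCharacter.IsPrimitive ∧ X₁.primitiveCharacter.Odd ∧
      ¬ (X₁.conductor = p ∧ ∀ a : ℤ, ¬ ((p : ℤ) ∣ a) →
          ‖X₁.primitiveCharacter (a : ZMod X₁.conductor) - (a : ℚ_[p])‖ < 1) ∧
      ‖@generalizedBernoulli ℚ_[p] _ _ X₁.conductor ⟨X₁.conductor_ne_zero⟩ 1 X₁.primitiveCharacter⁻¹‖ = 1) ∧
    (X₂.primitiveCharacter.IsPrimitive ∧ X₂.primitiveCharacter.Odd ∧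
      ¬ (X₂.conductor = p ∧ ∀ a : ℤ, ¬ ((p : ℤ) ∣ a) →
          ‖X₂.primitiveCharacter (a : ZMod X₂.conductor) - (a : ℚ_[p])‖ < 1) ∧
      ‖@generalizedBernoulli ℚ_[p] _ _ X₂.conductor ⟨X₂.conductor_ne_zero⟩ 1 X₂.primitiveCharacter⁻¹‖ = 1)) := by
  haveI : NeZero (NumberField.discr K).natAbs := ⟨Int.natAbs_ne_zero.mpr (NumberField.discr_ne_zero K)⟩
  have hp2 : p ≠ 2 := by have := hp.out.two_le; omega
  have hωodd : ω.Odd := KrizLiBinders.teichmuller_apply_neg_one hp2 hω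
  have hεq : εK⁻¹ = εK := inv_eq_self_of_isKroneckerCharacterOf K hεK
  have hεodd : εK.Odd := odd_of_isKroneckerCharacterOf K hK hεK
  obtain ⟨-, hall⟩ := norm_bernoulliPair_eq_one_of_heegner W hCM hram h5 N K ψ ω εK hN hK hH hω hss h4
  obtain ⟨hb1, hb2⟩ := hall ψ₁ hf hm hpM e
  refine ⟨mazurWiles_dirichletHypotheses_of_odd_of_norm_eq_one hp2 _ (evenTwist_mul_odd ψ₁ hεodd) ?_,
    mazurWiles_dirichletHypotheses_of_odd_of_norm_eq_one hp2 _ (evenTwist_inv_mul_odd ψ₁ hεodd hωodd) ?_⟩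
  · rw [evenTwist_mul_inv_eq_bernoulliCharOne ψ₁ hεq]; exact hb1
  · rw [evenTwist_inv_mul_inv_eq_bernoulliCharTwo ψ₁ εK ω]; exact hb2

/-- **THE TWO MAZUR–WILES INPUTS OF STUB H, `bernoulliOnePrim` / level-uniform currency** (w6's consumer hypotheses `hprim`,
`hodd`, `hχω`, `hB` verbatim) — same setting as `mazurWilesInputs_of_heegner`. [cite: MazurWiles1984, Thm. 2 (p. 216)]
[cite: KrizLi2019, Thm. 1.20 (pp. 7–8), §7.1 (p. 43)] -/
theorem mazurWilesInputs'_of_heegner (hCM : W.HasCM) (hram : CMRamified W p) (h5 : 5 ≤ p)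
    (N : ℕ) (K : Type) [Field K] [NumberField K]
    {f : ℕ} [NeZero f] (ψ : DirichletCharacter ℚ_[p] f) (ω : DirichletCharacter ℚ_[p] p)
    (εK : DirichletCharacter ℚ_[p] (NumberField.discr K).natAbs)
    (hN : W.conductorNorm ℤ = N) (hK : IsImaginaryQuadratic K) (hH : SatisfiesHeegnerHypothesis N K)
    (hω : IsTeichmullerCharacter ω)
    (hss : ∀ ℓ : ℕ, ℓ.Prime → ¬ (ℓ ∣ p * W.conductorNorm ℤ) →
      ‖((W.LFunction ℓ : ℤ) : ℚ_[p]) - (ψ (ℓ : ZMod f) + ψ⁻¹ (ℓ : ZMod f) * ω (ℓ : ZMod p))‖ < 1)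
    (hεK : IsKroneckerCharacterOf K εK)
    (h4 : ¬ ‖bernoulliOnePrim (bernoulliCharOne ψ εK) * bernoulliOnePrim (bernoulliCharTwo ψ εK ω)‖ ≤ (p : ℝ)⁻¹)
    {m : ℕ} [NeZero m] (ψ₁ : DirichletCharacter ℚ_[p] m) {M : ℕ} [NeZero M] (hf : f ∣ M) (hm : m ∣ M) (hpM : p ∣ M)
    (e : changeLevel hf ψ = changeLevel hm ψ₁ ∨ changeLevel hf ψ = changeLevel hm ψ₁⁻¹ * changeLevel hpM ω) :
    (haveI : NeZero (NumberField.discr K).natAbs := ⟨Int.natAbs_ne_zero.mpr (NumberField.discr_ne_zero K)⟩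
    let X₁ : DirichletCharacter ℚ_[p] (m * (NumberField.discr K).natAbs) :=
      evenTwist ψ₁ εK * changeLevel (dvd_mul_left (NumberField.discr K).natAbs m) εK
    let X₂ : DirichletCharacter ℚ_[p] (m * (NumberField.discr K).natAbs * p) :=
      changeLevel (dvd_mul_right (m * (NumberField.discr K).natAbs) p) (evenTwist ψ₁ εK)⁻¹ *
        changeLevel (dvd_mul_left p (m * (NumberField.discr K).natAbs)) ω
    haveI : NeZero X₁.conductor := ⟨X₁.conductor_ne_zero⟩
    haveI : NeZero X₂.conductor := ⟨X₂.conductor_ne_zero⟩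
    (X₁.primitiveCharacter.IsPrimitive ∧ X₁.primitiveCharacter.Odd ∧
      (¬ ∀ a : ℤ, ¬ ((p : ℤ) ∣ a) → ‖X₁.primitiveCharacter (a : ZMod X₁.conductor) - (a : ℚ_[p])‖ < 1) ∧
      ‖bernoulliOnePrim X₁.primitiveCharacter⁻¹‖ = 1) ∧
    (X₂.primitiveCharacter.IsPrimitive ∧ X₂.primitiveCharacter.Odd ∧
      (¬ ∀ a : ℤ, ¬ ((p : ℤ) ∣ a) → ‖X₂.primitiveCharacter (a : ZMod X₂.conductor) - (a : ℚ_[p])‖ < 1) ∧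
      ‖bernoulliOnePrim X₂.primitiveCharacter⁻¹‖ = 1)) := by
  haveI : NeZero (NumberField.discr K).natAbs := ⟨Int.natAbs_ne_zero.mpr (NumberField.discr_ne_zero K)⟩
  have hp2 : p ≠ 2 := by have := hp.out.two_le; omega
  have hωodd : ω.Odd := KrizLiBinders.teichmuller_apply_neg_one hp2 hω
  have hεq : εK⁻¹ = εK := inv_eq_self_of_isKroneckerCharacterOf K hεK
  have hεodd : εK.Odd := odd_of_isKroneckerCharacterOf K hK hεK
  obtain ⟨-, hall⟩ := norm_bernoulliPair_eq_one_of_heegner W hCM hram h5 N K ψ ω εK hN hK hH hω hss h4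
  obtain ⟨hb1, hb2⟩ := hall ψ₁ hf hm hpM e
  refine ⟨mazurWiles_dirichletHypotheses'_of_odd_of_norm_eq_one hp2 _ (evenTwist_mul_odd ψ₁ hεodd) ?_,
    mazurWiles_dirichletHypotheses'_of_odd_of_norm_eq_one hp2 _ (evenTwist_inv_mul_odd ψ₁ hεodd hωodd) ?_⟩
  · rw [evenTwist_mul_inv_eq_bernoulliCharOne ψ₁ hεq]; exact hb1
  · rw [evenTwist_inv_mul_inv_eq_bernoulliCharTwo ψ₁ εK ω]; exact hb2

end MazurWilesInputs

end Summit.BirchSwinnertonDyer.BirchSwinnertonDyer.Theorems.PrintCFram.BernoulliUnits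

end
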